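import Literature.AlgebraicGeometry.Morphisms.FormalModuleCompletionCokernel
import Literature.AlgebraicGeometry.Morphisms.FormalModuleKernel
import HarnessLib

/-!
# Algebraizing a coherent formal module from a presentation by completions (GW II Lemma 24.101 (1))

Görtz–Wedhorn, *Algebraic Geometry II* (2023), Lemma 24.101 (1) and Lemma 24.103 (pp. 569–570): if a
coherent `𝒪_{X/Z}`-module `ℱ` sits in an exact sequence `𝒢'_{/Z} —w→ 𝒢_{/Z} → ℱ → 0` whose first map
is the completion of a morphism `v : 𝒢' → 𝒢` (which is automatic for suitable sources, Cor. 24.100 /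
`Morphisms/FormalModuleHomFree`), then `ℱ ≅ coker(v)_{/Z}` is algebraizable.

In the tower language (`Morphisms/FormalModuleTower`, `…Completion`, `…Kernel`, `…CompletionCokernel`)
the presentation is produced in two steps, exactly as in the proof of Lemma 24.103: a levelwise
epimorphism `q : cmplTower a P → 𝓜`, its kernel `kerShift a q c` (a formal tower for a suitable
Artin–Rees shift `c`, `exists_isFormalTower_kerShift`) with augmentation ONTO the levelwise kernels
(`epi_kernel_lift_kerShiftAug`), and a levelwise epimorphism `q' : cmplTower a P' → kerShift a q c`.
This file proves the conclusion:

* `exact_cmplMapApp_of_presentation` — if `q' ≫ kerShiftAugHom = cmplMap a v`, then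
  `P'/aⁿ⁺¹ —v→ P/aⁿ⁺¹ —q_n→ 𝓜_n` is exact for every `n`;
* `isoOfPresentation` / `nonempty_iso_cmplObj_cokernel_of_presentation` — **hence
  `𝓜_n ≅ coker(v)/aⁿ⁺¹coker(v)` for every `n`: `𝓜` is (levelwise) the completion of the
  `𝒪_X`-module `coker v`.**

Everything is proved; no named facts.

## References

* U. Görtz, T. Wedhorn, *Algebraic Geometry II: Cohomology of Schemes*, Springer Spektrum (2023),
  Lemma 24.101 (1), Lemma 24.103 (pp. 569–570). [GortzWedhorn2023]
* A. Grothendieck, EGA III₁ (1961), 5.1–5.2. [EGAIII1]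
-/

noncomputable section

open CategoryTheory AlgebraicGeometry Limits TopologicalSpace Opposite
open Literature.AlgebraicGeometry.Modules

universe u

namespace Literature.AlgebraicGeometry.Morphisms

variable {X : Scheme.{u}} (a : Γ(X, ⊤)) {P' P : X.Modules} (v : P' ⟶ P) {𝓜 : ℕᵒᵖ ⥤ X.Modules}
  (q : cmplTower a P ⟶ 𝓜) (c : ℕ) (q' : cmplTower a P' ⟶ kerShift a q c)

/-- The components of a presentation `q' ≫ kerShiftAugHom = cmplMap a v`. [folklore] -/
theorem app_comp_kerShiftAug_of_presentation
    (hw : q' ≫ kerShiftAugHom q c (isFormalTower_cmplTower a P) = cmplMap a v) (n : ℕ) :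
    q'.app ⟨n⟩ ≫ kerShiftAug a q c (isFormalTower_cmplTower a P) n = cmplMapApp a v n := by
  have h := congrArg (fun φ => φ.app ⟨n⟩) hw
  simpa only [NatTrans.comp_app, kerShiftAugHom_app, cmplMap_app] using h

/-- `P'/aⁿ⁺¹ → P/aⁿ⁺¹ → 𝓜_n` vanishes. [folklore] -/
theorem cmplMapApp_comp_app_of_presentation
    (hw : q' ≫ kerShiftAugHom q c (isFormalTower_cmplTower a P) = cmplMap a v) (n : ℕ) :
    cmplMapApp a v n ≫ q.app ⟨n⟩ = 0 :=
  calc cmplMapApp a v n ≫ q.app ⟨n⟩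
      = (q'.app ⟨n⟩ ≫ kerShiftAug a q c (isFormalTower_cmplTower a P) n) ≫ q.app ⟨n⟩ :=
        congrArg (· ≫ q.app ⟨n⟩) (app_comp_kerShiftAug_of_presentation a v q c q' hw n).symm
    _ = q'.app ⟨n⟩ ≫ kerShiftAug a q c (isFormalTower_cmplTower a P) n ≫ q.app ⟨n⟩ :=
        Category.assoc _ _ _
    _ = q'.app ⟨n⟩ ≫ 0 := congrArg (q'.app ⟨n⟩ ≫ ·) (kerShiftAug_comp q c _ n)
    _ = 0 := comp_zero

/-- **Exactness of `P'/aⁿ⁺¹ —v→ P/aⁿ⁺¹ —q_n→ 𝓜_n`** when `q'` is a levelwise epimorphism onto the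
kernel tower and `q' ≫ kerShiftAugHom = cmplMap a v` (the augmentation maps onto `ker q_n`).
[cite: GortzWedhorn2023, Lemma 24.103, proof (p. 570)] -/
theorem exact_cmplMapApp_of_presentation [IsLocallyNoetherian X]
    (h𝓜 : IsFormalTower a 𝓜) (hPc : ∀ n, Coh ((cmplTower a P).obj ⟨n⟩)) (h𝓜c : ∀ n, Coh (𝓜.obj ⟨n⟩))
    (hq : ∀ n, Epi (q.app ⟨n⟩)) (hq' : ∀ n, Epi (q'.app ⟨n⟩))
    (hw : q' ≫ kerShiftAugHom q c (isFormalTower_cmplTower a P) = cmplMap a v) (n : ℕ) :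
    (ShortComplex.mk (cmplMapApp a v n) (q.app ⟨n⟩)
      (cmplMapApp_comp_app_of_presentation a v q c q' hw n)).Exact := by
  rw [ShortComplex.exact_iff_epi_kernel_lift]
  have hfac : kernel.lift (q.app ⟨n⟩) (cmplMapApp a v n)
      (cmplMapApp_comp_app_of_presentation a v q c q' hw n) =
      q'.app ⟨n⟩ ≫ kernel.lift (q.app ⟨n⟩) (kerShiftAug a q c (isFormalTower_cmplTower a P) n)
        (kerShiftAug_comp q c _ n) := by
    apply equalizer.hom_ext
    change kernel.lift _ _ _ ≫ kernel.ι (q.app ⟨n⟩) =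
      (q'.app ⟨n⟩ ≫ kernel.lift _ _ _) ≫ kernel.ι (q.app ⟨n⟩)
    rw [kernel.lift_ι, Category.assoc, kernel.lift_ι, app_comp_kerShiftAug_of_presentation a v q c q' hw n]
  change Epi (kernel.lift (q.app ⟨n⟩) (cmplMapApp a v n) _)
  rw [hfac]
  exact epi_comp' (hq' n)
    (epi_kernel_lift_kerShiftAug (u := q) (c := c) (isFormalTower_cmplTower a P) h𝓜 hPc h𝓜c hq n)

/-- **`𝓜_n ≅ coker(v)/aⁿ⁺¹ coker(v)`**: a coherent formal module presented by completions is,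
levelwise, the completion of `coker v` (GW II Lemma 24.101 (1)). [cite: GortzWedhorn2023, Lemma 24.101 (1) (p. 569)] -/
def isoOfPresentation [IsLocallyNoetherian X]
    (h𝓜 : IsFormalTower a 𝓜) (hPc : ∀ n, Coh ((cmplTower a P).obj ⟨n⟩)) (h𝓜c : ∀ n, Coh (𝓜.obj ⟨n⟩))
    (hq : ∀ n, Epi (q.app ⟨n⟩)) (hq' : ∀ n, Epi (q'.app ⟨n⟩))
    (hw : q' ≫ kerShiftAugHom q c (isFormalTower_cmplTower a P) = cmplMap a v) (n : ℕ) :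
    𝓜.obj ⟨n⟩ ≅ cmplObj a (cokernel v) n :=
  haveI : Epi (ShortComplex.mk (cmplMapApp a v n) (q.app ⟨n⟩)
      (cmplMapApp_comp_app_of_presentation a v q c q' hw n)).g := hq n
  (IsColimit.coconePointUniqueUpToIso
      (exact_cmplMapApp_of_presentation a v q c q' h𝓜 hPc h𝓜c hq hq' hw n).gIsCokernel
      (cokernelIsCokernel (cmplMapApp a v n))) ≪≫ cokernelCmplMapAppIso a v n

/-- `𝓜` is levelwise the completion of `coker v`. [cite: GortzWedhorn2023, Lemma 24.101 (1) (p. 569)] -/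
theorem nonempty_iso_cmplObj_cokernel_of_presentation [IsLocallyNoetherian X]
    (h𝓜 : IsFormalTower a 𝓜) (hPc : ∀ n, Coh ((cmplTower a P).obj ⟨n⟩)) (h𝓜c : ∀ n, Coh (𝓜.obj ⟨n⟩))
    (hq : ∀ n, Epi (q.app ⟨n⟩)) (hq' : ∀ n, Epi (q'.app ⟨n⟩))
    (hw : q' ≫ kerShiftAugHom q c (isFormalTower_cmplTower a P) = cmplMap a v) :
    ∀ n, Nonempty (𝓜.obj ⟨n⟩ ≅ (cmplTower a (cokernel v)).obj ⟨n⟩) :=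
  fun n => ⟨isoOfPresentation a v q c q' h𝓜 hPc h𝓜c hq hq' hw n⟩

end Literature.AlgebraicGeometry.Morphisms

end
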